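import Literature.AlgebraicGeometry.Resolution.BenitoVillamayor2013Cleaning
import HarnessLib

/-!
# Benito–Villamayor's `H-ord` at coefficient level: the MAXIMAL slope over changes of section, and its
# realisation by well-adapted (normal-form) presentations (BV 2013 Prop. 5.3 / Def. 5.5; BBE 2021 Def. 7.7, Rem. 7.8,
# Def. 7.9, Rem. 7.15)

Topic: `Literature/AlgebraicGeometry/Resolution`; sequel of `BenitoVillamayor2013Cleaning.lean`, whose vocabulary
(`BV2013.slope`, `coeffA`, `ordQuot`, `IsCaseA/B/B1/B2`, `SlopeIsPosInt`, `InitIsPow`, `IsWellAdapted`,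
`SlopeDichotomy`) and conventions (a base LOCAL ring `S` standing for `𝒪_{V^{(d)},β(ζ)}`, `ν` = the tree's `adicOrder`,
a monic `f ∈ S[X]` of degree `q = pᵉ` standing for the polynomial `f_{pᵉ}(z)` of a `p`-presentation, the rational number
`ord(ℛ_{𝒢,β})(y)` = «`ord_{β(ζ)} 𝒢^{(d)}`» carried as an explicit parameter `ρ : ℚ`, changes of section
`z ↦ z + α` = Mathlib `Polynomial.taylor α`) are kept verbatim.

Sources.
* A. Benito, O. E. Villamayor U., *Monoidal transforms and invariants of singularities in positive characteristic*,
  Compositio Math. **149** (2013) 1267–1311 [BenitoVillamayoru2013] (= arXiv:1004.1803v2, held text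
  `paper:arxiv-1004.1803`): Prop. 5.3 (cleaning raises the slope iff case B3)), Def. 5.5 (well-adapted presentations),
  Rem. 5.7 — all PROVED at coefficient level in `BenitoVillamayor2013Cleaning.lean`.
* A. Benito, A. Bravo, S. Encinas, *The asymptotic Samuel function and invariants of singularities*, Rev. Mat. Complut.
  **37** (2023) 603–652, doi:10.1007/s13163-023-00457-2 = arXiv:2107.14188 [BenitoBravoEncinas2023] (held text `paper:arxiv-2107.14188`; locators «chunk pNNNN Lk» are
  line k of the store file pNNNN.txt): Def. 7.5 (slope `Sl(𝒫)(ζ) := min{ν(a₁), …, ν(a_j)/j, …, ν(a_m)/m, ord 𝒢^{(d)}}`,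
  chunk p0019 L88–L99) · **Def. 7.7** «`β-ord(ζ) := sup_{z′} {Sl(𝒫(β,z′,fW^m))(ζ)}` where `z′` runs over all changes of
  the form `z′ = uz + s`» (chunk p0020 L8–L13) · **Rem. 7.8** «the value `β-ord(ξ)` does not depend on the choice of the
  transversal morphism `β`, nor on the choice of the order-one-element … Moreover, the supremum … is a maximum for a
  suitable selection of `z′`» (L16–L19) · Def. 7.9 `H-ord^{(d)}_X(ζ) := β-ord(ζ′)` (L24–L34) · Rem. 7.10 (L36–L45) · 7.13 «changes of the form
  `uz+s` produce a new `p`-presentation 𝒫′ with `Sl(𝒫′)(ζ) > Sl(𝒫)(ζ)` only in case (B3). In such case, only changes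
  of the section of the form `z′ := z + s` …» (chunk p0020 L93 – p0021 L2) · Def. 7.14 (normal form = «well-adapted
  presentation in [BVComp]», p0021 L8–L19) · **Rem. 7.15** «for a `p`-presentation … in normal form at `ζ`, it can be
  shown that `H-ord^{(d)}_X(ζ) = Sl(𝒫(β,z,hW^{p^ℓ}))(ζ)`» (p0021 L24–L31) · Example 1.3 (the same chain for
  `f = x^{p^ℓ} + a₁x^{p^ℓ−1} + … + a_{p^ℓ}`, «this supremum is a maximum», chunk p0005 L3–L36).

## What is typed and proved here (COEFFICIENT LEVEL, same generality and the same caveat as the parent file: the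
## elimination algebra is not an object of the tree, so `ρ` is a parameter and translations are the changes of section)

* `BV2013.slopeSet q f ρ` — the set `{Sl(f(X + α)) ; α ∈ S}` of slopes of all changes of section (Def. 7.7 with `u = 1`;
  by 7.13 units do not change the value for `p`-presentations);
* `BV2013.IsHOrd q f ρ v` — «`v` is the H-ord»: `v` is the GREATEST element of `slopeSet q f ρ`. The printed definition
  is a supremum that is ATTAINED (Rem. 7.8); following the tree's convention for such data
  (`HauserWagner2014.IsSlopeAt`, `HauserPerlega2024.IsFlagInvariant`) it is typed relationally as `IsGreatest`, so that
  no completeness of `WithTop ℚ` is used and existence is a separate theorem;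
* API: membership of every translate (`slope_taylor_mem_slopeSet`), uniqueness (`IsHOrd.unique`), the bound
  `v ≤ ρ` (`IsHOrd.le_coe`), invariance of `slopeSet`/`IsHOrd` under changes of section (`slopeSet_taylor`,
  `isHOrd_taylor_iff`), and the working criterion `isHOrd_slope_taylor_iff` («the translate `f(X+α₀)` realises H-ord iff
  no further change of section raises its slope»);
* **`isHOrd_of_isCaseA`**, **`isHOrd_of_isCaseB_of_not_initIsPow`**, **`isHOrd_of_isWellAdapted`** — Rem. 7.15 / Def. 5.5
  at coefficient level: a WELL-ADAPTED change of section realises the H-ord (cases A), B1), B2) via Prop. 5.3 of the parent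
  file; the two slope-zero clauses of Def. 5.5 (2) by a direct constant-coefficient argument, `residue_coeff_zero_eq_pow_of_forall_mem` / `exists_adicOrder_coeffA_eq_zero_of_residue_not_pow`);
* **`exists_isHOrd_of_slopeDichotomy`** (Rem. 7.8 «the supremum is a maximum», modulo Thm. 4.6 carried as the parent
  file carries it) and **`exists_isHOrd_pure`** (UNCONDITIONAL for pure heads `z^{pᵉ} + a`);
* **`isHOrd_X_pow_add_C_of_not_dvd`** — the calibration used by the campaign `res-hironaka` (cusps `y² + x^m`, `m` odd;
  `y^q + x^m`, `q ∤ m`): for a pure head `z^q + a` with `ν(a) = m`, `q ∤ m` and `m/q < ρ` the H-ord IS `m/q`, realised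
  by the presentation itself (case B1) — BBE Rem. 7.10's «`H-ord = 3/2 < ord(𝒢^{(1)}) = 2`» is the instance
  `q = 2, m = 3, ρ = 2`).

-- TODO(general form): β-independence (Rem. 7.8, first clause) and Def. 7.9's étale-neighbourhood clause need the
-- elimination algebra `ℛ_{𝒢,β}` / `𝒢^{(d)}` as objects (parent file's TODO); changes `z′ = uz + s` with a unit `u` are
-- omitted (7.13: they do not change the slope of a `p`-presentation).

No named fact (`def … : Prop` awaiting proof) is introduced. Every statement about H. Hironaka's 2017 manuscript is OUT of
scope of this file (the campaign consumes these theorems as Literature, D-0089/D-0124).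
-/

noncomputable section

namespace Literature.AlgebraicGeometry.Resolution

namespace BV2013

open Polynomial IsLocalRing

universe u

variable {S : Type u} [CommRing S]

/-! ## The set of translate slopes and the H-ord (Def. 7.7, Rem. 7.8, Def. 7.9 — coefficient level) -/

section Defs

variable [IsLocalRing S]

/-- The slopes of all changes of section `z ↦ z + α`: `{Sl(𝒫(β, z + α, fW^q))(ζ) ; α ∈ S}` (BBE Def. 7.7 with `u = 1`;
coefficient form, `ρ` for `ord 𝒢^{(d)}`). [cite: BenitoBravoEncinas2023, Def. 7.7, arXiv chunk p0020 L8–L13] -/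
def slopeSet (q : ℕ) (f : S[X]) (ρ : ℚ) : Set (WithTop ℚ) :=
  Set.range fun α : S => slope q (taylor α f) ρ

/-- **H-ord, coefficient form**: `v` is the H-ord of the presentation `f` (w.r.t. the parameter `ρ`) iff `v` is the
GREATEST slope among all changes of section — BBE Def. 7.7/7.9 «`β-ord(ζ) := sup_{z′} Sl(…)`», typed as `IsGreatest`
because «the supremum … is a maximum» (Rem. 7.8).
[cite: BenitoBravoEncinas2023, Def. 7.7, Rem. 7.8, Def. 7.9, arXiv chunk p0020 L8–L34] -/
def IsHOrd (q : ℕ) (f : S[X]) (ρ : ℚ) (v : WithTop ℚ) : Prop :=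
  IsGreatest (slopeSet q f ρ) v

/-- Every change of section contributes its slope to `slopeSet` (unfolding of Def. 7.7's index set «`z′` runs over all
changes …»). [cite: BenitoBravoEncinas2023, Def. 7.7, arXiv chunk p0020 L8–L13] -/
theorem slope_taylor_mem_slopeSet (q : ℕ) (f : S[X]) (ρ : ℚ) (α : S) :
    slope q (taylor α f) ρ ∈ slopeSet q f ρ :=
  ⟨α, rfl⟩

/-- The presentation itself (`α = 0`, no change of section) contributes its slope (Def. 7.7; Mathlib `taylor_zero`).
[cite: BenitoBravoEncinas2023, Def. 7.7, arXiv chunk p0020 L8–L13] -/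
theorem slope_mem_slopeSet (q : ℕ) (f : S[X]) (ρ : ℚ) : slope q f ρ ∈ slopeSet q f ρ :=
  ⟨0, by show slope q (taylor 0 f) ρ = slope q f ρ; rw [taylor_zero]⟩

/-- Unfolding of `IsHOrd`: `v` is a translate slope and bounds every translate slope — «sup … is a maximum» (Def. 7.7
with Rem. 7.8). [cite: BenitoBravoEncinas2023, Def. 7.7 and Rem. 7.8, arXiv chunk p0020 L8–L19 (Rem. 7.8 = L16–L19)] -/
theorem isHOrd_iff (q : ℕ) (f : S[X]) (ρ : ℚ) (v : WithTop ℚ) :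
    IsHOrd q f ρ v ↔ (∃ α : S, slope q (taylor α f) ρ = v) ∧ ∀ α : S, slope q (taylor α f) ρ ≤ v := by
  constructor
  · rintro ⟨⟨α, hα⟩, hub⟩
    exact ⟨⟨α, hα⟩, fun β => hub ⟨β, rfl⟩⟩
  · rintro ⟨⟨α, hα⟩, hub⟩
    refine ⟨⟨α, hα⟩, ?_⟩
    rintro _ ⟨β, rfl⟩
    exact hub β

/-- The H-ord is well defined (a greatest element is unique; Rem. 7.8 / Def. 7.9 speak of «the value β-ord(ξ)»).
[cite: BenitoBravoEncinas2023, Rem. 7.8 and Def. 7.9, arXiv chunk p0020 L16–L34] -/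
theorem IsHOrd.unique {q : ℕ} {f : S[X]} {ρ : ℚ} {v w : WithTop ℚ} (hv : IsHOrd q f ρ v) (hw : IsHOrd q f ρ w) :
    v = w :=
  IsGreatest.unique hv hw

/-- Every change of section has slope at most the H-ord. [cite: BenitoBravoEncinas2023, Def. 7.7, arXiv chunk p0020 L8–L13] -/
theorem IsHOrd.slope_taylor_le {q : ℕ} {f : S[X]} {ρ : ℚ} {v : WithTop ℚ} (hv : IsHOrd q f ρ v) (α : S) :
    slope q (taylor α f) ρ ≤ v :=
  hv.2 ⟨α, rfl⟩

/-- In particular `Sl(f) ≤ H-ord`. [cite: BenitoBravoEncinas2023, Def. 7.7, arXiv chunk p0020 L8–L13] -/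
theorem IsHOrd.slope_le {q : ℕ} {f : S[X]} {ρ : ℚ} {v : WithTop ℚ} (hv : IsHOrd q f ρ v) : slope q f ρ ≤ v :=
  hv.2 (slope_mem_slopeSet q f ρ)

/-- The H-ord is at most `ρ` (= `ord 𝒢^{(d)}`), since every slope is (Def. 7.5: the slope is a minimum containing
`ord 𝒢^{(d)}`). [cite: BenitoBravoEncinas2023, Def. 7.5, arXiv chunk p0019 L88–L99] -/
theorem IsHOrd.le_coe {q : ℕ} {f : S[X]} {ρ : ℚ} {v : WithTop ℚ} (hv : IsHOrd q f ρ v) :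
    v ≤ ((ρ : ℚ) : WithTop ℚ) := by
  obtain ⟨α, hα⟩ := hv.1
  rw [← hα]
  exact inf_le_right

/-- Changes of section compose (`(z + β) + α`): the translate-slope set — hence the supremum of Def. 7.7 — is the same
for every choice of section (Rem. 7.6: the slope «depends on the chosen data … the global section z», the supremum does
not). [cite: BenitoBravoEncinas2023, Rem. 7.6 and Def. 7.7, arXiv chunk p0020 L1–L13] (Mathlib `Polynomial.taylor_taylor`) -/
theorem slopeSet_taylor (q : ℕ) (f : S[X]) (ρ : ℚ) (β : S) : slopeSet q (taylor β f) ρ = slopeSet q f ρ := by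
  ext v
  constructor
  · rintro ⟨α, rfl⟩
    exact ⟨α + β, by
      show slope q (taylor (α + β) f) ρ = slope q (taylor α (taylor β f)) ρ
      rw [taylor_taylor]⟩
  · rintro ⟨α, rfl⟩
    exact ⟨α - β, by
      show slope q (taylor (α - β) (taylor β f)) ρ = slope q (taylor α f) ρ
      rw [taylor_taylor, sub_add_cancel]⟩

/-- The H-ord does not depend on the section: `IsHOrd (f(X+β)) v ↔ IsHOrd f v` (Def. 7.7 takes the supremum over ALL
sections). [cite: BenitoBravoEncinas2023, Rem. 7.6 and Def. 7.7, arXiv chunk p0020 L1–L13] -/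
theorem isHOrd_taylor_iff (q : ℕ) (f : S[X]) (ρ : ℚ) (β : S) (v : WithTop ℚ) :
    IsHOrd q (taylor β f) ρ v ↔ IsHOrd q f ρ v := by
  unfold IsHOrd
  rw [slopeSet_taylor]

/-- WORKING CRITERION: the change of section `α₀` realises the H-ord of `f` iff no further change of section raises
the slope of `f(X + α₀)` (this is how 7.13 / Rem. 7.15 are used). [cite: BenitoBravoEncinas2023, 7.13 and Rem. 7.15,
arXiv chunk p0020 L93 – p0021 L31] -/
theorem isHOrd_slope_taylor_iff (q : ℕ) (f : S[X]) (ρ : ℚ) (α₀ : S) :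
    IsHOrd q f ρ (slope q (taylor α₀ f) ρ) ↔
      ∀ α : S, slope q (taylor α (taylor α₀ f)) ρ ≤ slope q (taylor α₀ f) ρ := by
  rw [← isHOrd_taylor_iff q f ρ α₀, isHOrd_iff]
  constructor
  · rintro ⟨-, h⟩
    exact h
  · intro h
    exact ⟨⟨0, by show slope q (taylor 0 (taylor α₀ f)) ρ = _; rw [taylor_zero]⟩, h⟩

/-- Case **A)** realises the H-ord: if `Sl(f(X+α₀)) = ρ` then, every slope being `≤ ρ`, the H-ord is `ρ`
(normal form, Def. 7.14 (A)). [cite: BenitoBravoEncinas2023, Def. 7.14 (A) and Rem. 7.15, arXiv chunk p0021 L8–L31] -/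
theorem isHOrd_of_isCaseA {q : ℕ} {f : S[X]} {ρ : ℚ} {α₀ : S} (hA : IsCaseA q (taylor α₀ f) ρ) :
    IsHOrd q f ρ ((ρ : ℚ) : WithTop ℚ) := by
  refine ⟨⟨α₀, hA⟩, ?_⟩
  rintro _ ⟨α, rfl⟩
  exact inf_le_right

/-- A presentation one of whose coefficients `a_j` (`1 ≤ j ≤ q`) is a UNIT has slope `≤ 0` (hence `0`): `ν(a_j)/j = 0`
enters the minimum of Def. 7.5 / Def. 4.2. [cite: BenitoBravoEncinas2023, Def. 7.5, arXiv chunk p0019 L88–L99]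
[cite: BenitoVillamayoru2013, Def. 4.2, arXiv v2 p.13 l.50–57] -/
theorem slope_le_zero_of_adicOrder_eq_zero {q : ℕ} {g : S[X]} {ρ : ℚ} {j : ℕ} (hj1 : 1 ≤ j) (hjq : j ≤ q)
    (h : adicOrder (coeffA q g j) = 0) : slope q g ρ ≤ 0 := by
  have hmem : j ∈ Finset.Icc 1 q := Finset.mem_Icc.mpr ⟨hj1, hjq⟩
  have h0 : ordQuot (coeffA q g j) j = 0 := by
    rw [ordQuot_of_eq_natCast (m := 0) (by simpa using h) j]
    simp
  calc slope q g ρ ≤ ordQuot (coeffA q g j) j := inf_le_left.trans (Finset.inf_le hmem)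
    _ = 0 := h0

/-- Slopes are nonnegative when `ρ ≥ 0` (Def. 7.5 / Def. 4.2: a minimum of quotients of orders `ν ≥ 0` and of
`ord 𝒢^{(d)}`). [cite: BenitoBravoEncinas2023, Def. 7.5, arXiv chunk p0019 L88–L99]
[cite: BenitoVillamayoru2013, Def. 4.2, arXiv v2 p.13 l.50–57] -/
theorem slope_nonneg {q : ℕ} (g : S[X]) {ρ : ℚ} (hρ : 0 ≤ ρ) : 0 ≤ slope q g ρ := by
  refine le_inf (Finset.le_inf fun j _ => ?_) (by exact_mod_cast hρ)
  unfold ordQuot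
  induction adicOrder (coeffA q g j) using ENat.recTopCoe with
  | top => exact le_top
  | coe m =>
    show (0 : WithTop ℚ) ≤ (((m : ℚ) / (j : ℚ) : ℚ) : WithTop ℚ)
    exact_mod_cast div_nonneg (Nat.cast_nonneg m) (Nat.cast_nonneg j)

end Defs

/-! ## The constant coefficient under a change of section, and the slope-zero clause of Def. 5.5 (2) -/

section ConstantCoefficient

variable [IsLocalRing S]

/-- If ALL the coefficients `a′_1, …, a′_q` of a change of section `f(X + α)` of a MONIC `f` of degree `q ≥ 1` lie in `𝔪`,
then the constant coefficient `a_q = f(0)` of `f` is congruent to `(−α)^q` modulo `𝔪`: indeed `f(0) = f(X+α)(−α) =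
(−α)^q + Σ_{i<q} a′ ·(−α)^i`. Consequently the residue of `a_q` is a `q`-th power. (Characteristic-free; used for the
clause «`ā_{pᵉ} ∈ k(y)` is not a `pᵉ`-th power» of Def. 5.5 (2).) [cite: BenitoVillamayoru2013, Def. 5.5 (2) B2),
arXiv v2 p.18 l.18–23] -/
theorem residue_coeff_zero_eq_pow_of_forall_mem {q : ℕ} {f : S[X]} (hmon : f.Monic)
    (hdeg : f.natDegree = q) (α : S) (hall : ∀ i, i < q → (taylor α f).coeff i ∈ maximalIdeal S) :
    residue S (f.coeff 0) = (residue S (-α)) ^ q := by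
  -- `f = (f(X+α))(X − α)`, so `f(0) = (taylor α f).eval (−α)`
  have heval : f.coeff 0 = (taylor α f).eval (-α) := by
    rw [taylor_eval, neg_add_cancel, coeff_zero_eq_eval_zero]
  have hmon' : (taylor α f).Monic := by
    rw [Monic, leadingCoeff_taylor]; exact hmon
  have hdeg' : (taylor α f).natDegree = q := by rw [natDegree_taylor, hdeg]
  -- expand the evaluation as a sum over the coefficients
  rw [heval, eval_eq_sum_range, hdeg', Finset.sum_range_succ, map_add, map_sum]
  have hlead : (taylor α f).coeff q = 1 := by
    have := hmon'.coeff_natDegree; rwa [hdeg'] at this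
  rw [hlead, one_mul, map_pow]
  -- the lower terms vanish in the residue field
  have hzero : ∀ i ∈ Finset.range q, residue S ((taylor α f).coeff i * (-α) ^ i) = 0 := by
    intro i hi
    rw [map_mul, (residue_eq_zero_iff _).mpr (hall i (Finset.mem_range.mp hi)), zero_mul]
  rw [Finset.sum_eq_zero hzero, zero_add]

/-- Contrapositive, in the form used below: if the residue of `a_q = f(0)` is NOT a `q`-th power in `k = S/𝔪`, then EVERY
change of section `f(X + α)` has a unit among its coefficients `a′_1, …, a′_q` (some coefficient of index `< q` off `𝔪`),
hence slope `0`. [cite: BenitoVillamayoru2013, Def. 5.5 (2) B2) with Rem. 5.4, arXiv v2 p.18 l.14–23] -/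
theorem exists_adicOrder_coeffA_eq_zero_of_residue_not_pow {q : ℕ} {f : S[X]} (hmon : f.Monic)
    (hdeg : f.natDegree = q) (hres : ¬ ∃ b : ResidueField S, residue S (f.coeff 0) = b ^ q) (α : S) :
    ∃ j, 1 ≤ j ∧ j ≤ q ∧ adicOrder (coeffA q (taylor α f) j) = 0 := by
  by_contra hcon
  push Not at hcon
  apply hres
  refine ⟨residue S (-α), residue_coeff_zero_eq_pow_of_forall_mem hmon hdeg α fun i hi => ?_⟩
  -- coefficient `i < q` of `f(X+α)` is `a′_{q−i}` with `1 ≤ q − i ≤ q`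
  have hj := hcon (q - i) (by omega) (Nat.sub_le q i)
  have hcoeff : coeffA q (taylor α f) (q - i) = (taylor α f).coeff i := by
    simp [coeffA, Nat.sub_sub_self hi.le]
  rw [hcoeff] at hj
  -- `adicOrder c ≠ 0` means `c ∈ 𝔪`
  by_contra hnot
  apply hj
  have : adicOrder ((taylor α f).coeff i) ≤ ((0 : ℕ) : ℕ∞) := by
    rw [adicOrder_le_iff, zero_add, pow_one]
    exact hnot
  exact nonpos_iff_eq_zero.mp (by simpa using this)

end ConstantCoefficient

/-- For a pure head `z^q + a` the coefficients `a_j`, `1 ≤ j < q`, vanish. [folklore] -/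
private theorem coeffA_pure_of_lt {q j : ℕ} (a : S) (hj1 : 1 ≤ j) (hjq : j < q) :
    coeffA q (X ^ q + C a : S[X]) j = 0 := by
  simp only [coeffA, coeff_add, coeff_X_pow, coeff_C]
  have h1 : q - j ≠ q := by omega
  have h2 : q - j ≠ 0 := by omega
  simp [h1, h2]

/-! ## Well-adapted changes of section realise the H-ord (Rem. 7.15 / Def. 5.5 via Prop. 5.3) -/

section Regular

variable [IsRegularLocalRing S]

/-- Case **B) without B3)** realises the H-ord: if `f(X + α₀)` is in case B) (form (5.3.1)) and `In(a′_q)` is NOT a `q`-th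
power, then NO change of section raises its slope (Prop. 5.3, `exists_slope_lt_iff_initIsPow`, read contrapositively),
so `Sl(f(X+α₀))` is the greatest translate slope. `S` regular local of characteristic `p`, `f` monic of degree `pᵉ`.
Hypotheses as typed (reviewer note): print states Prop. 5.3 inside case B) of §5.1, where `Sl(p𝒫) > 0` is part of the
standing assumptions; here NO separate positivity hypothesis on the slope is carried — exactly the hypotheses of the
parent file's `exists_slope_lt_iff_initIsPow` (`IsCaseB` in its sharpened form (5.3.1)), so the statement is formally
stronger than the printed sentence and is proved as typed.
[cite: BenitoVillamayoru2013, Prop. 5.3, arXiv v2 p.17 l.23–29]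
[cite: BenitoBravoEncinas2023, 7.13 and Rem. 7.15, arXiv chunk p0020 L93 – p0021 L31] -/
theorem isHOrd_of_isCaseB_of_not_initIsPow {p : ℕ} (hp : p.Prime) [CharP S p] (e : ℕ) {f : S[X]} (hmon : f.Monic)
    (hdeg : f.natDegree = p ^ e) {ρ : ℚ} {α₀ : S} (hB : IsCaseB (p ^ e) (taylor α₀ f) ρ)
    (hnot : ¬ InitIsPow (p ^ e) (coeffA (p ^ e) (taylor α₀ f) (p ^ e))) :
    IsHOrd (p ^ e) f ρ (slope (p ^ e) (taylor α₀ f) ρ) := by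
  rw [isHOrd_slope_taylor_iff]
  intro α
  have hmon' : (taylor α₀ f).Monic := by rw [Monic, leadingCoeff_taylor]; exact hmon
  have hdeg' : (taylor α₀ f).natDegree = p ^ e := by rw [natDegree_taylor, hdeg]
  have hno : ¬ ∃ α : S, slope (p ^ e) (taylor α₀ f) ρ < slope (p ^ e) (taylor α (taylor α₀ f)) ρ :=
    fun h => hnot ((exists_slope_lt_iff_initIsPow hp e hmon' hdeg' hB).mp h)
  exact not_lt.mp fun hlt => hno ⟨α, hlt⟩

/-- In case **B1)** with positive slope, `In(a′_q)` cannot be a `q`-th power (a `q`-th power raising the order forces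
`ν(a′_q) = ℓq` with `ℓ ≥ 1`, Rem. 5.7 / `exists_order_eq_of_lt`), so B1) realises the H-ord.
[cite: BenitoVillamayoru2013, §5.1 B1) and Rem. 5.7, arXiv v2 p.16 l.51, p.18 l.30–35] -/
theorem isHOrd_of_isCaseB1 {p : ℕ} (hp : p.Prime) [CharP S p] (e : ℕ) {f : S[X]} (hmon : f.Monic)
    (hdeg : f.natDegree = p ^ e) {ρ : ℚ} {α₀ : S} (hB1 : IsCaseB1 (p ^ e) (taylor α₀ f) ρ)
    (hpos : 0 < slope (p ^ e) (taylor α₀ f) ρ) :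
    IsHOrd (p ^ e) f ρ (slope (p ^ e) (taylor α₀ f) ρ) := by
  set q := p ^ e with hqdef
  have hq : 0 < q := pow_pos hp.pos e
  obtain ⟨hB, hnotInt⟩ := hB1
  refine isHOrd_of_isCaseB_of_not_initIsPow hp e hmon hdeg hB ?_
  rintro ⟨α, hα⟩
  -- `ν(a′_q) = m` is finite (case B gives `m/q < ρ`)
  set a := coeffA q (taylor α₀ f) q with hadef
  have hfin : adicOrder a ≠ ⊤ := by
    intro htop
    have h1 := hB.1
    rw [← hadef] at h1
    simp only [ordQuot, htop] at h1
    exact absurd h1 (not_lt_of_ge le_top)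
  obtain ⟨m, hm⟩ := ENat.ne_top_iff_exists.mp hfin
  have hm' : adicOrder a = (m : ℕ∞) := hm.symm
  obtain ⟨ℓ, hmℓ, hαℓ⟩ := exists_order_eq_of_lt hq hm' hα
  -- positivity of the slope gives `m > 0`, hence `ℓ > 0`
  have hslope : slope q (taylor α₀ f) ρ = ordQuot a q := slope_eq_of_isCaseB hq hB
  have hmpos : 0 < m := by
    by_contra h0
    have h0' : m = 0 := by omega
    rw [hslope, ordQuot_of_eq_natCast hm' q, h0'] at hpos
    simp at hpos
  have hℓpos : 0 < ℓ := by
    rcases Nat.eq_zero_or_pos ℓ with h | h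
    · rw [h, zero_mul] at hmℓ; omega
    · exact h
  exact hnotInt ⟨ℓ, hℓpos, by rw [← hadef, hm', hmℓ]⟩

/-- Case **B2)** realises the H-ord (`In(a′_q)` not a `q`-th power by definition of B2)).
[cite: BenitoVillamayoru2013, §5.1 B2), arXiv v2 p.16 l.53] -/
theorem isHOrd_of_isCaseB2 {p : ℕ} (hp : p.Prime) [CharP S p] (e : ℕ) {f : S[X]} (hmon : f.Monic)
    (hdeg : f.natDegree = p ^ e) {ρ : ℚ} {α₀ : S} (hB2 : IsCaseB2 (p ^ e) (taylor α₀ f) ρ) :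
    IsHOrd (p ^ e) f ρ (slope (p ^ e) (taylor α₀ f) ρ) :=
  isHOrd_of_isCaseB_of_not_initIsPow hp e hmon hdeg hB2.1 hB2.2.2

/-- **Rem. 7.15 at coefficient level (with Def. 5.5): a WELL-ADAPTED change of section realises the H-ord.** If
`f(X + α₀)` is well-adapted — positive slope in case A), B1) or B2), or slope `0` with `ρ = 0`, or slope `0` with
`ν(a′_q) = 0 < ρ` and `ā′_q` not a `q`-th power of the residue field — then `Sl(f(X+α₀))` is the GREATEST slope over all
changes of section, i.e. the H-ord: «for a `p`-presentation … in normal form at `ζ`, `H-ord^{(d)}_X(ζ) = Sl(𝒫)(ζ)`».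
`S` regular local of characteristic `p`, `f` monic of degree `pᵉ`.
[cite: BenitoBravoEncinas2023, Rem. 7.15 (with Def. 7.14), arXiv chunk p0021 L8–L31]
[cite: BenitoVillamayoru2013, Def. 5.5 and Prop. 5.3, arXiv v2 p.17 l.23–29, p.18 l.18–23] -/
theorem isHOrd_of_isWellAdapted {p : ℕ} (hp : p.Prime) [CharP S p] (e : ℕ) {f : S[X]} (hmon : f.Monic)
    (hdeg : f.natDegree = p ^ e) {ρ : ℚ} {α₀ : S} (hW : IsWellAdapted (p ^ e) (taylor α₀ f) ρ) :
    IsHOrd (p ^ e) f ρ (slope (p ^ e) (taylor α₀ f) ρ) := by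
  set q := p ^ e with hqdef
  have hq : 0 < q := pow_pos hp.pos e
  have hmon' : (taylor α₀ f).Monic := by rw [Monic, leadingCoeff_taylor]; exact hmon
  have hdeg' : (taylor α₀ f).natDegree = q := by rw [natDegree_taylor, hdeg]
  rcases hW with ⟨hpos, hA | hB1 | hB2⟩ | ⟨h0, hρ | ⟨ha0, hρpos, hres⟩⟩
  · -- case A) with positive slope
    rw [hA]; exact isHOrd_of_isCaseA hA
  · exact isHOrd_of_isCaseB1 hp e hmon hdeg hB1 hpos
  · exact isHOrd_of_isCaseB2 hp e hmon hdeg hB2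
  · -- slope 0 and `ρ = 0`: every slope is `≤ ρ = 0`
    rw [isHOrd_slope_taylor_iff]
    intro α
    rw [h0]
    calc slope q (taylor α (taylor α₀ f)) ρ ≤ ((ρ : ℚ) : WithTop ℚ) := inf_le_right
      _ = 0 := by rw [hρ]; rfl
  · -- slope 0, `ν(a′_q) = 0 < ρ`, residue of `a′_q` not a `q`-th power: every translate has a unit coefficient
    rw [isHOrd_slope_taylor_iff]
    intro α
    rw [h0]
    have hres' : ¬ ∃ b : ResidueField S, residue S ((taylor α₀ f).coeff 0) = b ^ q := by
      rwa [← coeffA_self q (taylor α₀ f)]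
    obtain ⟨j, hj1, hjq, hj⟩ :=
      exists_adicOrder_coeffA_eq_zero_of_residue_not_pow hmon' hdeg' hres' α
    exact slope_le_zero_of_adicOrder_eq_zero hj1 hjq hj

/-- **Existence (Rem. 7.8 «the supremum is a maximum»), modulo Thm. 4.6 as the parent file carries it**: for `f` monic
of degree `pᵉ` with positive slope, if every change of section satisfies the conclusion of Thm. 4.6 (`SlopeDichotomy`),
then SOME change of section realises the H-ord — the well-adapted one reached by the cleaning process
(`exists_isWellAdapted_taylor`, Rem. 5.7). [cite: BenitoBravoEncinas2023, Rem. 7.8, arXiv chunk p0020 L16–L19]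
[cite: BenitoVillamayoru2013, Rem. 5.7, arXiv v2 p.18 l.29–44] -/
theorem exists_isHOrd_of_slopeDichotomy {p : ℕ} (hp : p.Prime) [CharP S p] (e : ℕ) {f : S[X]} (hmon : f.Monic)
    (hdeg : f.natDegree = p ^ e) {ρ : ℚ} (hpos : 0 < slope (p ^ e) f ρ)
    (h46 : ∀ α : S, SlopeDichotomy (p ^ e) (taylor α f) ρ) :
    ∃ α : S, IsHOrd (p ^ e) f ρ (slope (p ^ e) (taylor α f) ρ) := by
  obtain ⟨α, hα⟩ := exists_isWellAdapted_taylor hp e hmon hdeg hpos h46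
  exact ⟨α, isHOrd_of_isWellAdapted hp e hmon hdeg hα⟩

/-- **Existence for PURE heads, unconditional**: for `z^{pᵉ} + a` over a regular local ring of characteristic `p` with
positive slope, some change of section `z ↦ z + α` (which keeps the head pure: `z^{pᵉ} + (α^{pᵉ} + a)`) realises the
H-ord (Thm. 4.6 is vacuous for pure heads, `slopeDichotomy_X_pow_add_C`). This is Example 1.3's «this supremum is a
maximum since there is a change of variables … for which `H-ord^{(d)}_X(ζ) = min{ν(a′_{p^ℓ})/p^ℓ, ord^{(d)}_X(ζ)}`» for
the purely inseparable equation. [cite: BenitoBravoEncinas2023, Example 1.3, arXiv chunk p0005 L3–L36] -/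
theorem exists_isHOrd_pure {p : ℕ} (hp : p.Prime) [CharP S p] (e : ℕ) (a : S) {ρ : ℚ}
    (hpos : 0 < slope (p ^ e) (X ^ (p ^ e) + C a) ρ) :
    ∃ α : S, IsHOrd (p ^ e) (X ^ (p ^ e) + C a : S[X]) ρ (slope (p ^ e) (X ^ (p ^ e) + C (α ^ (p ^ e) + a)) ρ) := by
  have hq : p ^ e ≠ 0 := (pow_pos hp.pos e).ne'
  obtain ⟨α, hα⟩ := exists_isHOrd_of_slopeDichotomy hp e (monic_X_pow_add_C a hq) (natDegree_X_pow_add_C) hpos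
    (fun α => by rw [taylor_X_pow_add_C_charPow hp e a α]; exact slopeDichotomy_X_pow_add_C _ _ _)
  exact ⟨α, by rw [← taylor_X_pow_add_C_charPow hp e a α]; exact hα⟩

/-! ## Calibration: pure heads `z^q + a` with `q ∤ ν(a)` (the cusps `y² + x^m`, `m` odd, of BBE Rem. 7.10) -/

/-- **Calibration.** `S` regular local of characteristic `p`, `q = pᵉ`, `a ∈ S` with `ν(a) = m`, `q ∤ m`, and
`m/q < ρ`: the pure head `z^q + a` is in case B1) with positive slope, hence realises its own H-ord, which IS `m/q`
(no change of section raises it). Instances: the characteristic-`2` cusps `y² + x^m`, `m` odd, over `𝒪 = k⟦x⟧` or any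
regular local ring with `ν(x) = 1` (H-ord `= m/2`; BBE Rem. 7.10 prints the case `m = 3`: «`H-ord^{(d)}_X(ξ) = 3/2 <
ord_{β(ξ)}(𝒢^{(1)}) = 2`»), and `y^q + x^m`, `q ∤ m`.
[cite: BenitoBravoEncinas2023, Rem. 7.10 and Rem. 7.15, arXiv chunk p0020 L36–L45, p0021 L24–L31]
[cite: BenitoVillamayoru2013, §5.1 B1) and Def. 5.5 (1), arXiv v2 p.16 l.51, p.18 l.18–23] -/
theorem isHOrd_X_pow_add_C_of_not_dvd {p : ℕ} (hp : p.Prime) [CharP S p] (e : ℕ) {a : S} {m : ℕ}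
    (ha : adicOrder a = (m : ℕ∞)) (hndvd : ¬ p ^ e ∣ m) {ρ : ℚ} (hρ : (m : ℚ) / (p ^ e : ℕ) < ρ) :
    IsHOrd (p ^ e) (X ^ (p ^ e) + C a : S[X]) ρ ((((m : ℚ) / (p ^ e : ℕ) : ℚ)) : WithTop ℚ) := by
  set q := p ^ e with hqdef
  have hq : 0 < q := pow_pos hp.pos e
  have hqne : q ≠ 0 := hq.ne'
  set f : S[X] := X ^ q + C a with hfdef
  have hmon : f.Monic := monic_X_pow_add_C a hqne
  have hdeg : f.natDegree = q := natDegree_X_pow_add_C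
  have haq : coeffA q f q = a := by simp [hfdef, coeffA_self, Ne.symm hqne]
  -- case B in the form (5.3.1): `ν(a)/q < ρ` and `< ν(a_j)/j = ⊤` for `j < q`
  have hB : IsCaseB q f ρ := by
    refine ⟨?_, fun j hj => ?_⟩
    · rw [haq]; exact (ordQuot_lt_coe_iff ha q ρ).mpr hρ
    · rcases Finset.mem_Ico.mp hj with ⟨hj1, hjq⟩
      rw [coeffA_pure_of_lt a hj1 hjq, haq, ordQuot_of_eq_natCast ha q]
      simp only [ordQuot, adicOrder_zero]
      exact WithTop.coe_lt_top _
  -- not B-integral: `m = ℓ·q` is excluded by `q ∤ m`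
  have hnotInt : ¬ SlopeIsPosInt q f := by
    rintro ⟨ℓ, -, hℓ⟩
    rw [haq, ha] at hℓ
    have : m = ℓ * q := by exact_mod_cast hℓ
    exact hndvd ⟨ℓ, by rw [this, Nat.mul_comm]⟩
  -- positive slope: `m ≥ 1` since `q ∤ m`
  have hmpos : 0 < m := Nat.pos_of_ne_zero fun h => hndvd (h ▸ dvd_zero q)
  have hslope : slope q f ρ = ((((m : ℚ) / (q : ℕ) : ℚ)) : WithTop ℚ) := by
    rw [slope_eq_of_isCaseB hq hB, haq, ordQuot_of_eq_natCast ha q]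
  have hpos : 0 < slope q f ρ := by
    rw [hslope]
    exact_mod_cast div_pos (by exact_mod_cast hmpos) (by exact_mod_cast hq)
  have hW : IsWellAdapted q (taylor 0 f) ρ := by
    rw [taylor_zero]
    exact Or.inl ⟨hpos, Or.inr (Or.inl ⟨hB, hnotInt⟩)⟩
  have h := isHOrd_of_isWellAdapted hp e hmon hdeg hW
  rwa [taylor_zero, hslope] at h

end Regular

end BV2013

end Literature.AlgebraicGeometry.Resolution

end
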